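import Mathlib
import Literature.Analysis.ODE.HolomorphicLinearODEStarConvex
import Summits.AtomisticToContinuum.HydrodynamicLimit.Theorems.ImplosionDichotomyDenseExcursionSonicSlavingWedgePieces
import Summits.AtomisticToContinuum.HydrodynamicLimit.Theorems.ImplosionDichotomyDenseExcursionSonicSlavingAnalyticMode

/-!
# The complex characteristic system of a smooth radial mode: near the sonic point, and on star-shaped pieces of the wedge
# (crux `DenseExcursion`, line `sonic-cavity-renewal` v7, bricks for the registered stub `stub_sonicSlaving`)

Helper file (`--supports stmt-AtomisticToContinuum-12586`, line lead a2, stub-worker A (wave 3) for `stub_sonicSlaving`).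

With a holomorphic continuation `Wc, Sc` of the profile to the sonic wedge (the data of `CavityTubeWedge`, part C of the tube),
the COMPLEX CHARACTERISTIC SYSTEM of the mode equations is
  `c₊ P′ = (Λ − b₊₊) P − b₊₋ M`, `c₋ M′ = −b₋₊ P + (Λ − b₋₋) M`,
  `c± = (Wc − 1) ± Sc`, `b₊₊ = ⅔Wc′ + 2Wc − r + 2Sc′ + 4Sc`, `b₊₋ = Wc′/3 + Sc′ + 2Sc`, `b₋₊ = Wc′/3 − Sc′ − 2Sc`, `b₋₋ = ⅔Wc′ + 2Wc − r − 2Sc′ − 4Sc`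
(real trace = `mode_char_system`). This file proves:

* `complexChar_of_localMode` (registered helper): the local holomorphic pair `(F, G)` of `smoothMode_analyticAt_sonic` (real
  trace = the mode on `|x| < δ`) satisfies, as `P₀ = F + 3G`, `M₀ = F − 3G`, the complex characteristic system on the whole
  disc `‖z‖ < δ` — the two residuals are holomorphic on the disc and vanish on the real diameter (identity theorem);
* `exists_charOperator`, `hasDerivAt_pair_of_complexChar`, `complexChar_of_hasDerivAt_pair`: away from the sonic point
  (`c₊ c₋ ≠ 0`) the system is the regular linear system `v′ = A(z) v` with the holomorphic `2 × 2` coefficient operator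
  `A = [[(Λ − b₊₊)/c₊, −b₊₋/c₊], [−b₋₊/c₋, (Λ − b₋₋)/c₋]]` on `ℂ × ℂ` (packaged existentially), and the two forms are equivalent;
* `exists_complexChar_on_starConvex`: on an open star-shaped piece of the PUNCTURED wedge there is a holomorphic solution through
  any prescribed value at the star centre, unique among differentiable solutions — the Literature theorem
  `Literature.Analysis.ODE.exists_holomorphic_linearODE_of_starConvex` / `linearODE_unique_of_starConvex` applied to `A`.

The gluing over the cover `…SonicSlavingWedgePieces` (continuation to the whole wedge) is the next file. No citation is
load-bearing (Coddington–Levinson Ch. 3 §7 via the Literature module).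
-/

noncomputable section

open Set Filter Metric Complex
open scoped Topology

namespace Summit.AtomisticToContinuum.HydrodynamicLimit.Theorems.SonicCavityRenewal

open Summit.AtomisticToContinuum.HydrodynamicLimit.Theorems.R2OneModeTwoConditions


/-! ## The local pair solves the complex characteristic system -/

/-- The derivative of a function holomorphic on the wedge is holomorphic on the wedge. [folklore] -/
theorem differentiableOn_deriv_sonicWedge {f : ℂ → ℂ} (hf : DifferentiableOn ℂ f sonicWedge) :
    DifferentiableOn ℂ (deriv f) sonicWedge :=
  ((hf.analyticOnNhd isOpen_sonicWedge).deriv).differentiableOn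

/-- At a real point of `(−4/5, 1/20)` the complex derivative of the continuation `Wc` is the real derivative of `W`. [folklore] -/
theorem deriv_continuation_ofReal {Wc : ℂ → ℂ} {W : ℝ → ℝ} (hWc : DifferentiableOn ℂ Wc sonicWedge) (hW : Differentiable ℝ W)
    (htr : ∀ x : ℝ, -(4 / 5 : ℝ) < x → x < 1 / 20 → Wc x = W x) {x : ℝ} (h1 : -(4 / 5 : ℝ) < x) (h2 : x < 1 / 20) :
    deriv Wc x = ((deriv W x : ℝ) : ℂ) := by
  refine deriv_eq_of_realTrace (hWc.differentiableAt (isOpen_sonicWedge.mem_nhds (ofReal_mem_sonicWedge h1 h2)))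
    (hW x).hasDerivAt.ofReal_comp ?_
  filter_upwards [Ioo_mem_nhds h1 h2] with t ht using htr t ht.1 ht.2

/-- **THE LOCAL HOLOMORPHIC PAIR SOLVES THE COMPLEX CHARACTERISTIC SYSTEM** — registered helper `complexChar_of_localMode` for
`stub_sonicSlaving`. Let `Wc, Sc` be holomorphic on the wedge with real traces `W, S` on `(−4/5, 1/20)` (`W, S` differentiable),
`(ŵ, ŝ)` a differentiable solution of the mode equations, and `P₀, M₀` holomorphic on the disc `‖z‖ < δ ≤ 1/20` with real traces
`ŵ + 3ŝ`, `ŵ − 3ŝ` on `|x| < δ`. Then `P₀, M₀` satisfy the complex characteristic system on the whole disc (both residuals are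
holomorphic there and vanish on the real diameter by `mode_char_system`; identity theorem). [folklore] -/
theorem complexChar_of_localMode : ∀ (r : ℝ) (W S : ℝ → ℝ) (Wc Sc : ℂ → ℂ) (Λ : ℂ) (ŵ ŝ : ℝ → ℂ) (P₀ M₀ : ℂ → ℂ) (δ : ℝ), Differentiable ℝ W → Differentiable ℝ S → DifferentiableOn ℂ Wc sonicWedge → DifferentiableOn ℂ Sc sonicWedge → (∀ x : ℝ, -(4 / 5 : ℝ) < x → x < 1 / 20 → Wc x = W x ∧ Sc x = S x) → Differentiable ℝ ŵ → Differentiable ℝ ŝ → (∀ x, Λ * ŵ x = linW r W S ŵ ŝ x ∧ Λ * ŝ x = linS r W S ŵ ŝ x) → 0 < δ → δ ≤ 1 / 20 → DifferentiableOn ℂ P₀ (Metric.ball 0 δ) → DifferentiableOn ℂ M₀ (Metric.ball 0 δ) → (∀ x : ℝ, |x| < δ → P₀ x = ŵ x + 3 * ŝ x ∧ M₀ x = ŵ x - 3 * ŝ x) → ∀ z ∈ Metric.ball (0 : ℂ) δ, (Wc z - 1 + Sc z) * deriv P₀ z = (Λ - (2 / 3 * deriv Wc z + 2 * Wc z - r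 + 2 * deriv Sc z + 4 * Sc z)) * P₀ z - (deriv Wc z / 3 + deriv Sc z + 2 * Sc z) * M₀ z ∧ (Wc z - 1 - Sc z) * deriv M₀ z = -(deriv Wc z / 3 - deriv Sc z - 2 * Sc z) * P₀ z + (Λ - (2 / 3 * deriv Wc z + 2 * Wc z - r - 2 * deriv Sc z - 4 * Sc z)) * M₀ z := by
  intro r W S Wc Sc Λ ŵ ŝ P₀ M₀ δ hW hS hWc hSc htr hŵ hŝ heq hδ hδ20 hP hM htr0
  have hsub : ball (0 : ℂ) δ ⊆ sonicWedge := ball_subset_sonicWedge hδ20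
  -- holomorphy of all ingredients on the disc
  have hWd : DifferentiableOn ℂ Wc (ball 0 δ) := hWc.mono hsub
  have hSd : DifferentiableOn ℂ Sc (ball 0 δ) := hSc.mono hsub
  have hWd' : DifferentiableOn ℂ (deriv Wc) (ball 0 δ) := (differentiableOn_deriv_sonicWedge hWc).mono hsub
  have hSd' : DifferentiableOn ℂ (deriv Sc) (ball 0 δ) := (differentiableOn_deriv_sonicWedge hSc).mono hsub
  have hPd' : DifferentiableOn ℂ (deriv P₀) (ball 0 δ) := ((hP.analyticOnNhd isOpen_ball).deriv).differentiableOn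
  have hMd' : DifferentiableOn ℂ (deriv M₀) (ball 0 δ) := ((hM.analyticOnNhd isOpen_ball).deriv).differentiableOn
  -- the two residuals
  set R1 : ℂ → ℂ := fun z => (Wc z - 1 + Sc z) * deriv P₀ z -
      ((Λ - (2 / 3 * deriv Wc z + 2 * Wc z - r + 2 * deriv Sc z + 4 * Sc z)) * P₀ z - (deriv Wc z / 3 + deriv Sc z + 2 * Sc z) * M₀ z)
    with hR1
  set R2 : ℂ → ℂ := fun z => (Wc z - 1 - Sc z) * deriv M₀ z -
      (-(deriv Wc z / 3 - deriv Sc z - 2 * Sc z) * P₀ z + (Λ - (2 / 3 * deriv Wc z + 2 * Wc z - r - 2 * deriv Sc z - 4 * Sc z)) * M₀ z)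
    with hR2
  have hR1d : DifferentiableOn ℂ R1 (ball 0 δ) := by
    simp only [hR1]
    exact ((hWd.sub_const 1).add hSd).mul hPd' |>.sub
      ((((differentiableOn_const Λ).sub ((((hWd'.const_mul _).add (hWd.const_mul _)).sub_const _).add (hSd'.const_mul _)
        |>.add (hSd.const_mul _))).mul hP).sub (((hWd'.div_const 3).add hSd' |>.add (hSd.const_mul _)).mul hM))
  have hR2d : DifferentiableOn ℂ R2 (ball 0 δ) := by
    simp only [hR2]
    exact ((hWd.sub_const 1).sub hSd).mul hMd' |>.sub
      (((((hWd'.div_const 3).sub hSd').sub (hSd.const_mul _)).neg.mul hP).add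
        (((differentiableOn_const Λ).sub ((((hWd'.const_mul _).add (hWd.const_mul _)).sub_const _).sub (hSd'.const_mul _)
          |>.sub (hSd.const_mul _))).mul hM))
  -- the residuals vanish at real points of the disc
  have hreal : ∀ x : ℝ, 0 < x → x < δ → R1 x = 0 ∧ R2 x = 0 := by
    intro x hx0 hxδ
    have hx1 : -(4 / 5 : ℝ) < x := by linarith
    have hx2 : x < 1 / 20 := by linarith
    have hxball : (x : ℂ) ∈ ball (0 : ℂ) δ := by
      rw [mem_ball_zero_iff, Complex.norm_real, Real.norm_eq_abs, abs_of_pos hx0]; exact hxδ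
    obtain ⟨eW, eS⟩ := htr x hx1 hx2
    have edW := deriv_continuation_ofReal hWc hW (fun t h1 h2 => (htr t h1 h2).1) hx1 hx2
    have edS := deriv_continuation_ofReal hSc hS (fun t h1 h2 => (htr t h1 h2).2) hx1 hx2
    obtain ⟨eP, eM⟩ := htr0 x (by rw [abs_of_pos hx0]; exact hxδ)
    obtain ⟨dp, dm⟩ := hasDerivAt_char_components (hŵ x) (hŝ x)
    have hnear : ∀ᶠ t : ℝ in 𝓝 x, |t| < δ := by
      filter_upwards [Ioo_mem_nhds (by linarith : -δ < x) hxδ] with t ht using abs_lt.2 ht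
    have edP : deriv P₀ x = deriv ŵ x + 3 * deriv ŝ x :=
      deriv_eq_of_realTrace (hP.differentiableAt (isOpen_ball.mem_nhds hxball)) dp (hnear.mono fun t ht => (htr0 t ht).1)
    have edM : deriv M₀ x = deriv ŵ x - 3 * deriv ŝ x :=
      deriv_eq_of_realTrace (hM.differentiableAt (isOpen_ball.mem_nhds hxball)) dm (hnear.mono fun t ht => (htr0 t ht).2)
    obtain ⟨c1, c2⟩ := mode_char_system (heq x)
    push_cast at c1 c2
    simp only [hR1, hR2, eW, eS, edW, edS, eP, eM, edP, edM]
    constructor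
    · linear_combination c1
    · linear_combination c2
  -- identity theorem
  have h1 := eqOn_zero_ball_of_ofReal hδ hR1d fun x hx0 hxδ => (hreal x hx0 hxδ).1
  have h2 := eqOn_zero_ball_of_ofReal hδ hR2d fun x hx0 hxδ => (hreal x hx0 hxδ).2
  intro z hz
  exact ⟨sub_eq_zero.1 (h1 z hz), sub_eq_zero.1 (h2 z hz)⟩


/-! ## The regular system on the punctured wedge: the coefficient operator -/

/-- **THE COEFFICIENT OPERATOR.** On a set `V ⊆ sonicWedge` on which both complex characteristic speeds `c± = Wc − 1 ± Sc` do not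
vanish, the solved form of the complex characteristic system is `v′ = A(z) v` with the `2 × 2` operator
`A = [[(Λ − b₊₊)/c₊, −b₊₋/c₊], [−b₋₊/c₋, (Λ − b₋₋)/c₋]]` on `ℂ × ℂ`, holomorphic on `V` (packaged existentially: no definition is
posited). [folklore] -/
theorem exists_charOperator (r : ℝ) (Wc Sc : ℂ → ℂ) (Λ : ℂ) {V : Set ℂ} (hVW : V ⊆ sonicWedge)
    (hWc : DifferentiableOn ℂ Wc sonicWedge) (hSc : DifferentiableOn ℂ Sc sonicWedge) (hcp : ∀ z ∈ V, Wc z - 1 + Sc z ≠ 0)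
    (hcm : ∀ z ∈ V, Wc z - 1 - Sc z ≠ 0) :
    ∃ A : ℂ → (ℂ × ℂ →L[ℂ] ℂ × ℂ), DifferentiableOn ℂ A V ∧ ∀ (z : ℂ) (v : ℂ × ℂ), A z v =
      ((Λ - (2 / 3 * deriv Wc z + 2 * Wc z - r + 2 * deriv Sc z + 4 * Sc z)) / (Wc z - 1 + Sc z) * v.1 +
          -(deriv Wc z / 3 + deriv Sc z + 2 * Sc z) / (Wc z - 1 + Sc z) * v.2,
        -(deriv Wc z / 3 - deriv Sc z - 2 * Sc z) / (Wc z - 1 - Sc z) * v.1 +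
          (Λ - (2 / 3 * deriv Wc z + 2 * Wc z - r - 2 * deriv Sc z - 4 * Sc z)) / (Wc z - 1 - Sc z) * v.2) := by
  set a11 : ℂ → ℂ := fun z => (Λ - (2 / 3 * deriv Wc z + 2 * Wc z - r + 2 * deriv Sc z + 4 * Sc z)) / (Wc z - 1 + Sc z)
    with ha11
  set a12 : ℂ → ℂ := fun z => -(deriv Wc z / 3 + deriv Sc z + 2 * Sc z) / (Wc z - 1 + Sc z) with ha12
  set a21 : ℂ → ℂ := fun z => -(deriv Wc z / 3 - deriv Sc z - 2 * Sc z) / (Wc z - 1 - Sc z) with ha21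
  set a22 : ℂ → ℂ := fun z => (Λ - (2 / 3 * deriv Wc z + 2 * Wc z - r - 2 * deriv Sc z - 4 * Sc z)) / (Wc z - 1 - Sc z)
    with ha22
  have hWd : DifferentiableOn ℂ Wc V := hWc.mono hVW
  have hSd : DifferentiableOn ℂ Sc V := hSc.mono hVW
  have hWd' : DifferentiableOn ℂ (deriv Wc) V := (differentiableOn_deriv_sonicWedge hWc).mono hVW
  have hSd' : DifferentiableOn ℂ (deriv Sc) V := (differentiableOn_deriv_sonicWedge hSc).mono hVW
  have hcpd : DifferentiableOn ℂ (fun z => Wc z - 1 + Sc z) V := (hWd.sub_const 1).add hSd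
  have hcmd : DifferentiableOn ℂ (fun z => Wc z - 1 - Sc z) V := (hWd.sub_const 1).sub hSd
  have ha11d : DifferentiableOn ℂ a11 V := ((differentiableOn_const Λ).sub ((((hWd'.const_mul _).add (hWd.const_mul _)).sub_const _
    |>.add (hSd'.const_mul _)).add (hSd.const_mul _))).div hcpd hcp
  have ha12d : DifferentiableOn ℂ a12 V := (((hWd'.div_const 3).add hSd').add (hSd.const_mul _)).neg.div hcpd hcp
  have ha21d : DifferentiableOn ℂ a21 V := (((hWd'.div_const 3).sub hSd').sub (hSd.const_mul _)).neg.div hcmd hcm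
  have ha22d : DifferentiableOn ℂ a22 V := ((differentiableOn_const Λ).sub ((((hWd'.const_mul _).add (hWd.const_mul _)).sub_const _
    |>.sub (hSd'.const_mul _)).sub (hSd.const_mul _))).div hcmd hcm
  set E11 : ℂ × ℂ →L[ℂ] ℂ × ℂ := (ContinuousLinearMap.inl ℂ ℂ ℂ).comp (ContinuousLinearMap.fst ℂ ℂ ℂ) with hE11
  set E12 : ℂ × ℂ →L[ℂ] ℂ × ℂ := (ContinuousLinearMap.inl ℂ ℂ ℂ).comp (ContinuousLinearMap.snd ℂ ℂ ℂ) with hE12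
  set E21 : ℂ × ℂ →L[ℂ] ℂ × ℂ := (ContinuousLinearMap.inr ℂ ℂ ℂ).comp (ContinuousLinearMap.fst ℂ ℂ ℂ) with hE21
  set E22 : ℂ × ℂ →L[ℂ] ℂ × ℂ := (ContinuousLinearMap.inr ℂ ℂ ℂ).comp (ContinuousLinearMap.snd ℂ ℂ ℂ) with hE22
  refine ⟨fun z => a11 z • E11 + a12 z • E12 + a21 z • E21 + a22 z • E22,
    (((ha11d.smul_const E11).add (ha12d.smul_const E12)).add (ha21d.smul_const E21)).add (ha22d.smul_const E22), fun z v => ?_⟩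
  simp [hE11, hE12, hE21, hE22, ha11, ha12, ha21, ha22]

/-- **Multiplied form ⇒ solved form** at a point of an open set on which the speeds do not vanish: a differentiable pair
satisfying the complex characteristic system at `z` has `(P, M)′(z) = A(z)(P, M)(z)`. [folklore] -/
theorem hasDerivAt_pair_of_complexChar {r : ℝ} {Wc Sc : ℂ → ℂ} {Λ : ℂ} {V : Set ℂ} {A : ℂ → (ℂ × ℂ →L[ℂ] ℂ × ℂ)}
    (hA : ∀ (z : ℂ) (v : ℂ × ℂ), A z v =
      ((Λ - (2 / 3 * deriv Wc z + 2 * Wc z - r + 2 * deriv Sc z + 4 * Sc z)) / (Wc z - 1 + Sc z) * v.1 +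
          -(deriv Wc z / 3 + deriv Sc z + 2 * Sc z) / (Wc z - 1 + Sc z) * v.2,
        -(deriv Wc z / 3 - deriv Sc z - 2 * Sc z) / (Wc z - 1 - Sc z) * v.1 +
          (Λ - (2 / 3 * deriv Wc z + 2 * Wc z - r - 2 * deriv Sc z - 4 * Sc z)) / (Wc z - 1 - Sc z) * v.2))
    (hV : IsOpen V) {P M : ℂ → ℂ} (hP : DifferentiableOn ℂ P V) (hM : DifferentiableOn ℂ M V) {z : ℂ} (hz : z ∈ V)
    (hcp : Wc z - 1 + Sc z ≠ 0) (hcm : Wc z - 1 - Sc z ≠ 0)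
    (h1 : (Wc z - 1 + Sc z) * deriv P z = (Λ - (2 / 3 * deriv Wc z + 2 * Wc z - r + 2 * deriv Sc z + 4 * Sc z)) * P z -
      (deriv Wc z / 3 + deriv Sc z + 2 * Sc z) * M z)
    (h2 : (Wc z - 1 - Sc z) * deriv M z = -(deriv Wc z / 3 - deriv Sc z - 2 * Sc z) * P z +
      (Λ - (2 / 3 * deriv Wc z + 2 * Wc z - r - 2 * deriv Sc z - 4 * Sc z)) * M z) :
    HasDerivAt (fun w => (P w, M w)) (A z (P z, M z) + (0 : ℂ × ℂ)) z := by
  have aux1 : ∀ (c' X Y p m d : ℂ), c' ≠ 0 → c' * d = X * p + Y * m → d = X / c' * p + Y / c' * m := by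
    intro c' X Y p m d hc' h
    field_simp
    linear_combination h
  have dP : HasDerivAt P (deriv P z) z := (hP.differentiableAt (hV.mem_nhds hz)).hasDerivAt
  have dM : HasDerivAt M (deriv M z) z := (hM.differentiableAt (hV.mem_nhds hz)).hasDerivAt
  refine (dP.prodMk dM).congr_deriv ?_
  rw [add_zero, hA]
  have e1 := aux1 (Wc z - 1 + Sc z) (Λ - (2 / 3 * deriv Wc z + 2 * Wc z - r + 2 * deriv Sc z + 4 * Sc z))
    (-(deriv Wc z / 3 + deriv Sc z + 2 * Sc z)) (P z) (M z) (deriv P z) hcp (by linear_combination h1)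
  have e2 := aux1 (Wc z - 1 - Sc z) (-(deriv Wc z / 3 - deriv Sc z - 2 * Sc z))
    (Λ - (2 / 3 * deriv Wc z + 2 * Wc z - r - 2 * deriv Sc z - 4 * Sc z)) (P z) (M z) (deriv M z) hcm
    (by linear_combination h2)
  rw [e1, e2]

/-- **Solved form ⇒ multiplied form**: if `(P, M)′(z) = A(z)(P, M)(z)` then the complex characteristic system holds at `z`
(with `deriv`). [folklore] -/
theorem complexChar_of_hasDerivAt_pair {r : ℝ} {Wc Sc : ℂ → ℂ} {Λ : ℂ} {A : ℂ → (ℂ × ℂ →L[ℂ] ℂ × ℂ)}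
    (hA : ∀ (z : ℂ) (v : ℂ × ℂ), A z v =
      ((Λ - (2 / 3 * deriv Wc z + 2 * Wc z - r + 2 * deriv Sc z + 4 * Sc z)) / (Wc z - 1 + Sc z) * v.1 +
          -(deriv Wc z / 3 + deriv Sc z + 2 * Sc z) / (Wc z - 1 + Sc z) * v.2,
        -(deriv Wc z / 3 - deriv Sc z - 2 * Sc z) / (Wc z - 1 - Sc z) * v.1 +
          (Λ - (2 / 3 * deriv Wc z + 2 * Wc z - r - 2 * deriv Sc z - 4 * Sc z)) / (Wc z - 1 - Sc z) * v.2))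
    {F : ℂ → ℂ × ℂ} {z : ℂ} (hF : HasDerivAt F (A z (F z) + (0 : ℂ × ℂ)) z) (hcp : Wc z - 1 + Sc z ≠ 0)
    (hcm : Wc z - 1 - Sc z ≠ 0) :
    (Wc z - 1 + Sc z) * deriv (fun w => (F w).1) z =
        (Λ - (2 / 3 * deriv Wc z + 2 * Wc z - r + 2 * deriv Sc z + 4 * Sc z)) * (F z).1 -
          (deriv Wc z / 3 + deriv Sc z + 2 * Sc z) * (F z).2 ∧
      (Wc z - 1 - Sc z) * deriv (fun w => (F w).2) z = -(deriv Wc z / 3 - deriv Sc z - 2 * Sc z) * (F z).1 +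
        (Λ - (2 / 3 * deriv Wc z + 2 * Wc z - r - 2 * deriv Sc z - 4 * Sc z)) * (F z).2 := by
  have aux2 : ∀ (c' X Y p m : ℂ), c' ≠ 0 → c' * (X / c' * p + Y / c' * m) = X * p + Y * m := by
    intro c' X Y p m hc'
    field_simp
  have d1 : HasDerivAt (fun w => (F w).1) ((A z (F z) + 0).1) z := (ContinuousLinearMap.fst ℂ ℂ ℂ).hasFDerivAt.comp_hasDerivAt z hF
  have d2 : HasDerivAt (fun w => (F w).2) ((A z (F z) + 0).2) z := (ContinuousLinearMap.snd ℂ ℂ ℂ).hasFDerivAt.comp_hasDerivAt z hF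
  rw [d1.deriv, d2.deriv, add_zero, hA]
  have f1 := aux2 (Wc z - 1 + Sc z) (Λ - (2 / 3 * deriv Wc z + 2 * Wc z - r + 2 * deriv Sc z + 4 * Sc z))
    (-(deriv Wc z / 3 + deriv Sc z + 2 * Sc z)) (F z).1 (F z).2 hcp
  have f2 := aux2 (Wc z - 1 - Sc z) (-(deriv Wc z / 3 - deriv Sc z - 2 * Sc z))
    (Λ - (2 / 3 * deriv Wc z + 2 * Wc z - r - 2 * deriv Sc z - 4 * Sc z)) (F z).1 (F z).2 hcm
  constructor
  · linear_combination f1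
  · linear_combination f2

/-! ## Existence and uniqueness on star-shaped pieces -/

/-- **HOLOMORPHIC SOLUTIONS OF THE COMPLEX CHARACTERISTIC SYSTEM ON A STAR-SHAPED PIECE OF THE PUNCTURED WEDGE, EXISTENCE AND
UNIQUENESS.** On an open set `V ⊆ sonicWedge`, star-convex with respect to `c ∈ V`, on which both complex characteristic speeds
do not vanish: for every `(p₀, m₀)` there is a holomorphic solution `(P, M)` on `V` with `(P, M)(c) = (p₀, m₀)`, and every
differentiable solution on `V` with the same value at `c` coincides with it on `V`
(`Literature.Analysis.ODE.exists_holomorphic_linearODE_of_starConvex`, `…linearODE_unique_of_starConvex`). [folklore] -/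
theorem exists_complexChar_on_starConvex : ∀ (r : ℝ) (Wc Sc : ℂ → ℂ) (Λ : ℂ) (V : Set ℂ) (c p₀ m₀ : ℂ), IsOpen V → StarConvex ℝ c V → c ∈ V → V ⊆ sonicWedge → DifferentiableOn ℂ Wc sonicWedge → DifferentiableOn ℂ Sc sonicWedge → (∀ z ∈ V, Wc z - 1 + Sc z ≠ 0) → (∀ z ∈ V, Wc z - 1 - Sc z ≠ 0) → ∃ P M : ℂ → ℂ, DifferentiableOn ℂ P V ∧ DifferentiableOn ℂ M V ∧ P c = p₀ ∧ M c = m₀ ∧ (∀ z ∈ V, (Wc z - 1 + Sc z) * deriv P z = (Λ - (2 / 3 * deriv Wc z + 2 * Wc z - r + 2 * deriv Sc z + 4 * Sc z)) * P z - (deriv Wc z / 3 + deriv Sc z + 2 * Sc z) * M z ∧ (Wc z - 1 - Sc z) * deriv M z = -(deriv Wc z / 3 - deriv Sc z - 2 * Sc z) * P z + (Λ - (2 / 3 * deriv Wc z + 2 * Wc z - r - 2 * deriv Sc z - 4 * Sc z)) * M z) ∧ ∀ P' M' : ℂ → ℂ, DifferentiableOn ℂ P' V → DifferentiableOn ℂ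 M' V → P' c = p₀ → M' c = m₀ → (∀ z ∈ V, (Wc z - 1 + Sc z) * deriv P' z = (Λ - (2 / 3 * deriv Wc z + 2 * Wc z - r + 2 * deriv Sc z + 4 * Sc z)) * P' z - (deriv Wc z / 3 + deriv Sc z + 2 * Sc z) * M' z ∧ (Wc z - 1 - Sc z) * deriv M' z = -(deriv Wc z / 3 - deriv Sc z - 2 * Sc z) * P' z + (Λ - (2 / 3 * deriv Wc z + 2 * Wc z - r - 2 * deriv Sc z - 4 * Sc z)) * M' z) → ∀ z ∈ V, P' z = P z ∧ M' z = M z := by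
  intro r Wc Sc Λ V c p₀ m₀ hV hst hc hVW hWc hSc hcp hcm
  obtain ⟨A, hAd, hA⟩ := exists_charOperator r Wc Sc Λ hVW hWc hSc hcp hcm
  obtain ⟨F, hFd, hF0, hF'⟩ := Literature.Analysis.ODE.exists_holomorphic_linearODE_of_starConvex hV hst hAd
    (differentiableOn_const (0 : ℂ × ℂ)) (p₀, m₀)
  have _ := hc
  refine ⟨fun z => (F z).1, fun z => (F z).2, hFd.fst, hFd.snd, by simp [hF0], by simp [hF0],
    fun z hz => complexChar_of_hasDerivAt_pair hA (hF' z hz) (hcp z hz) (hcm z hz), ?_⟩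
  intro P' M' hP' hM' hP'0 hM'0 hsol z hz
  have hG' : ∀ w ∈ V, HasDerivAt (fun w => (P' w, M' w)) (A w (P' w, M' w) + (0 : ℂ × ℂ)) w :=
    fun w hw => hasDerivAt_pair_of_complexChar hA hV hP' hM' hw (hcp w hw) (hcm w hw) (hsol w hw).1 (hsol w hw).2
  have huniq := Literature.Analysis.ODE.linearODE_unique_of_starConvex hV hst hAd.continuousOn hG' hF'
    (by rw [hF0, hP'0, hM'0]) hz
  simp only at huniq
  exact ⟨congrArg Prod.fst huniq, congrArg Prod.snd huniq⟩

end Summit.AtomisticToContinuum.HydrodynamicLimit.Theorems.SonicCavityRenewal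

end
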